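import Summits.CriticalPhenomena.PercolationContinuityZ3.Theorems.PercNearOneGluingNoHeavyLowerTailKnQuestion8CoefficientwiseCoreClassKernelMixHubBundleSlices
import HarnessLib

/-!
# H≼_J FOR EVERY BUNDLE Θ(ℓ₁, …, ℓ_r): hub-Kleitman for the gated cluster class (thread induction, memo-50 §2.6)

Support file (`--supports stmt-CriticalPhenomena-4575`, closed), prover `prim-cplus-coupling` (gen 52).  No definitions, no notations,
no named facts, no sorries; standard axioms.  Memo `prim-cplus-coupling/A5-COUPLING-gen50.md` §2.1, §2.6 (REDUCTION THEOREM),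
`A5-COUPLING-gen51.md` §2.6, §3, §7(2).

**THEOREM (CONJECTURE H≼_J of memo-50, now proved for all bundles, word form)** `hubBundle_HJ`.  Let `Θ = Θ(ℓ 0, …, ℓ (r-1))`
be a bundle of `r` internally disjoint `u–b` paths (`ℓ t ≥ 1`), words `ω ⊆ E r` (red edges `(t,k)`), thread words `θ t ω`, per-thread
hub runs `ri ra rj rb` (wall formulas of `…KernelMixHubWalls`), and hub traces (index sets, `(t,0) ↦ u`, `(t, ℓ t) ↦ b`)
  `TX g r ω = ⋃_t {t} × ([0, ri_t] ∪ (if g ∨ [some thread fully red] then [ℓ t − rj_t, ℓ t] else ∅))`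
(`g = false`: the red cluster `C_u(ω)`; `g = true`: `C_u(ω) ∪ C_b(ω)`) and `TY` likewise with the blue runs `ra, rb` (the red traces of
the complementary colouring).  For gates `gX, gY ∈ {u, j}`, ARBITRARY monotone predicates `𝒳, 𝒴` on index sets,
`W(ω) :⟺ ¬𝒳(TX gX ω) ∧ 𝒴(TY gY ω)` and `cW(ω) :⟺ ¬𝒳(TY gX ω) ∧ 𝒴(TX gY ω)` (`= W` of the complement), and EVERY finite family `F`
of words closed under hub moves (on any thread: add a prefix `[1,a]` of the leading blue run and/or a suffix `[b+1, ℓ t]` of the trailing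
blue run):  `#(F ∩ W) ≤ #(F ∩ cW)`.
PROOF = memo-50 §2.6 verbatim: induction on `r`; `Θ_{r+1} = Θ_r ∥ P_r`, the split `ω ↦ (ω|Θ_r, θ r ω)` is a bijection onto the product,
the hub order and complementation are the product ones (…HubBundleJoin), the class of gated trace sets is closed under slicing in both
directions (CLOSURE LEMMA, …HubBundleTrace/…HubBundleSlices), the factors satisfy the inequality by the induction hypothesis resp. by the
PATH LEMMA (…HubBundlePath ← …HubPathJGate/JU/Flip/One ← the augmented staircase theorem …HubClosed), and the PRODUCT LEMMA
`hubProduct_card_le` (…KernelMixHubProduct) glues.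
**COROLLARY (HE PURE LEMMA on every bundle, memo-50 §2.3(a))** `hubBundle_HEpure`: for all monotone 0/1 levels `𝐀, 𝐁, 𝐂, 𝐃` on
index sets and every ⊆-up-set `𝒱` of colourings, `#{ω ∈ 𝒱 : bad₁ ω} ≤ #{ω ∈ 𝒱 : L₁ ω}` where, with `X = TX false r ω`, `Y = TY false r ω` and
'`b ∈ X`' = some `(t, ℓ t) ∈ X`: `bad₁ = [b∉X][b∈Y][X∈𝐀][Y∉𝐁][Y∈𝐃][X∉𝐂]`, `L₁ = [b∈X][b∉Y][X∈𝐀][Y∉𝐁][X∈𝐃][Y∉𝐂]` — the instance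
`𝒳 = 𝐂 ∪ ↑b`, `𝒴 = 𝐃 ∩ ↑b`, `F = 𝒱 ∩ hro` (the single-type half of LP1(Θ); by `𝐀↔𝐂, 𝐁↔𝐃` also `#bad₂(𝒱) ≤ #L₂(𝒱)`; the two-type
statement LP1(Θ) with shared targets `L₁ ∪ L₂ ∪ P₁` remains open).  The cluster-form dictionary is `…KernelMixBundleWords`.
[cite: KozmaNitzan2024, Questions 8–9 (§5.5 p. 36) (context); Kleitman 1966 (the star case); Harris 1960]
-/

namespace Summit.CriticalPhenomena.PercolationContinuityZ3.Theorems

open Finset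
open scoped symmDiff

namespace Coefficientwise

set_option maxHeartbeats 400000 in
open Classical in
/-- **THEOREM H≼_J (hub-Kleitman for the gated class) on every bundle `Θ(ℓ 0, …, ℓ (r-1))`, all four gate types, all monotone
`𝒳, 𝒴`, all hub-up-sets `F`** (module docstring). [folklore] -/
theorem hubBundle_HJ (ℓ : ℕ → ℕ) (hℓ : ∀ t, 1 ≤ ℓ t)
    (E : ℕ → Finset (ℕ × ℕ)) (hE : ∀ n p, p ∈ E n ↔ p.1 < n ∧ 1 ≤ p.2 ∧ p.2 ≤ ℓ p.1)
    (θ : ℕ → Finset (ℕ × ℕ) → Finset ℕ) (hθ : ∀ t ω k, k ∈ θ t ω ↔ (t, k) ∈ ω)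
    (D : ℕ → Finset ℕ → Finset ℕ) (hD : ∀ t η, D t η = (Icc 1 (ℓ t - 1)).filter (fun k => ¬ (k ∈ η ↔ k + 1 ∈ η)))
    (ri ra rj rb : ℕ → Finset ℕ → ℕ)
    (hri : ∀ t η, ri t η = if 1 ∈ η then (if h : (D t η).Nonempty then (D t η).min' h else ℓ t) else 0)
    (hra : ∀ t η, ra t η = if 1 ∈ η then 0 else (if h : (D t η).Nonempty then (D t η).min' h else ℓ t))
    (hrj : ∀ t η, rj t η = if ℓ t ∈ η then (if h : (D t η).Nonempty then ℓ t - (D t η).max' h else ℓ t) else 0)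
    (hrb : ∀ t η, rb t η = if ℓ t ∈ η then 0 else (if h : (D t η).Nonempty then ℓ t - (D t η).max' h else ℓ t))
    (TX TY : Bool → ℕ → Finset (ℕ × ℕ) → Finset (ℕ × ℕ))
    (hTX : ∀ g n ω, TX g n ω = (range n).biUnion (fun t => (Icc 0 (ri t (θ t ω)) ∪
      (if (g = true ∨ ∃ s, s < n ∧ ri s (θ s ω) = ℓ s) then Icc (ℓ t - rj t (θ t ω)) (ℓ t) else ∅)).image (Prod.mk t)))
    (hTY : ∀ g n ω, TY g n ω = (range n).biUnion (fun t => (Icc 0 (ra t (θ t ω)) ∪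
      (if (g = true ∨ ∃ s, s < n ∧ ra s (θ s ω) = ℓ s) then Icc (ℓ t - rb t (θ t ω)) (ℓ t) else ∅)).image (Prod.mk t)))
    (r : ℕ) :
    ∀ (gX gY : Bool) (X Y : Finset (ℕ × ℕ) → Prop),
      (∀ S T : Finset (ℕ × ℕ), S ⊆ T → X S → X T) → (∀ S T : Finset (ℕ × ℕ), S ⊆ T → Y S → Y T) →
      ∀ (W cW : Finset (ℕ × ℕ) → Prop),
        (∀ ω, W ω ↔ ¬ X (TX gX r ω) ∧ Y (TY gY r ω)) → (∀ ω, cW ω ↔ ¬ X (TY gX r ω) ∧ Y (TX gY r ω)) →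
        ∀ F : Finset (Finset (ℕ × ℕ)), (∀ ω ∈ F, ω ⊆ E r) →
          (∀ ω ∈ F, ∀ t, t < r → ∀ a b : ℕ, a ≤ b → b ≤ ℓ t → (∀ k ∈ θ t ω, a < k) → (∀ k ∈ θ t ω, k ≤ b) →
            ω ∪ (Icc 1 a ∪ Icc (b + 1) (ℓ t)).image (Prod.mk t) ∈ F) →
          (F.filter (fun ω => W ω)).card ≤ (F.filter (fun ω => cW ω)).card := by
  induction r with
  | zero =>
    intro gX gY X Y _ _ W cW hW hcW F _ _
    have h0 : ∀ g ω, TX g 0 ω = ∅ ∧ TY g 0 ω = ∅ := by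
      intro g ω
      constructor
      · ext p; rw [hubB_mem_trace ℓ θ ri rj TX hTX]; simp
      · ext p; rw [hubB_mem_trace ℓ θ ra rb TY hTY]; simp
    have heq : F.filter (fun ω => W ω) = F.filter (fun ω => cW ω) :=
      Finset.filter_congr fun ω _ => by rw [hW, hcW, (h0 gX ω).1, (h0 gX ω).2, (h0 gY ω).1, (h0 gY ω).2]
    rw [heq]
  | succ r ih =>
    intro gX gY X Y hXm hYm W cW hW hcW F hFsub hFup
    -- the two hub relations (single hub moves or equality)
    obtain ⟨rel₁, hrel₁⟩ : ∃ rel₁ : Finset (ℕ × ℕ) → Finset (ℕ × ℕ) → Prop, ∀ x y, rel₁ x y ↔ (x = y ∨ ∃ t, t < r ∧ ∃ a b : ℕ,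
        a ≤ b ∧ b ≤ ℓ t ∧ (∀ k ∈ θ t x, a < k) ∧ (∀ k ∈ θ t x, k ≤ b) ∧ y = x ∪ (Icc 1 a ∪ Icc (b + 1) (ℓ t)).image (Prod.mk t)) :=
      ⟨_, fun _ _ => Iff.rfl⟩
    obtain ⟨rel₂, hrel₂⟩ : ∃ rel₂ : Finset ℕ → Finset ℕ → Prop, ∀ ζ ξ, rel₂ ζ ξ ↔ (ζ = ξ ∨ ∃ a b : ℕ,
        a ≤ b ∧ b ≤ ℓ r ∧ (∀ k ∈ ζ, a < k) ∧ (∀ k ∈ ζ, k ≤ b) ∧ ξ = ζ ∪ Icc 1 a ∪ Icc (b + 1) (ℓ r)) := ⟨_, fun _ _ => Iff.rfl⟩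
    -- the two classes
    obtain ⟨C₁, hC₁⟩ : ∃ C₁ : Finset (Finset (ℕ × ℕ)) → Prop, ∀ W₁, C₁ W₁ ↔ ∃ (g₁ g₂ : Bool) (X₁ Y₁ : Finset (ℕ × ℕ) → Prop),
        (∀ S T : Finset (ℕ × ℕ), S ⊆ T → X₁ S → X₁ T) ∧ (∀ S T : Finset (ℕ × ℕ), S ⊆ T → Y₁ S → Y₁ T) ∧
        W₁ = (E r).powerset.filter (fun ω => ¬ X₁ (TX g₁ r ω) ∧ Y₁ (TY g₂ r ω)) := ⟨_, fun _ => Iff.rfl⟩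
    obtain ⟨C₂, hC₂⟩ : ∃ C₂ : Finset (Finset ℕ) → Prop, ∀ W₂, C₂ W₂ ↔ ∃ (g₁ g₂ : Bool) (X₂ Y₂ : Finset ℕ → Prop),
        (∀ S T : Finset ℕ, S ⊆ T → X₂ S → X₂ T) ∧ (∀ S T : Finset ℕ, S ⊆ T → Y₂ S → Y₂ T) ∧
        W₂ = (Icc 1 (ℓ r)).powerset.filter (fun ζ => ¬ X₂ (Icc 0 (ri r ζ) ∪ (if g₁ = true then Icc (ℓ r - rj r ζ) (ℓ r) else ∅)) ∧
          Y₂ (Icc 0 (ra r ζ) ∪ (if g₂ = true then Icc (ℓ r - rb r ζ) (ℓ r) else ∅))) := ⟨_, fun _ => Iff.rfl⟩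
    -- H(Θ_r): the induction hypothesis in set form
    have H₁ : ∀ W₁ F₁ : Finset (Finset (ℕ × ℕ)), C₁ W₁ → (∀ x y, rel₁ x y → x ∈ F₁ → y ∈ F₁) →
        (F₁ ∩ W₁).card ≤ (F₁ ∩ W₁.image (fun x => x ∆ E r)).card := by
      intro W₁ F₁ hC hF₁
      obtain ⟨g₁, g₂, X₁, Y₁, hX₁, hY₁, rfl⟩ := (hC₁ W₁).mp hC
      obtain ⟨Wp, hWp⟩ : ∃ Wp : Finset (ℕ × ℕ) → Prop, ∀ ω, Wp ω ↔ ¬ X₁ (TX g₁ r ω) ∧ Y₁ (TY g₂ r ω) := ⟨_, fun _ => Iff.rfl⟩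
      obtain ⟨cWp, hcWp⟩ : ∃ cWp : Finset (ℕ × ℕ) → Prop, ∀ ω, cWp ω ↔ ¬ X₁ (TY g₁ r ω) ∧ Y₁ (TX g₂ r ω) := ⟨_, fun _ => Iff.rfl⟩
      have heq : (E r).powerset.filter (fun ω => ¬ X₁ (TX g₁ r ω) ∧ Y₁ (TY g₂ r ω)) = (E r).powerset.filter (fun ω => Wp ω) :=
        Finset.filter_congr fun ω _ => (hWp ω).symm
      rw [heq, (hubB_compl_filter ℓ hℓ E hE θ hθ D hD ri ra rj rb hri hra hrj hrb TX TY hTX hTY r g₁ g₂ X₁ Y₁ Wp cWp hWp hcWp).2,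
        Finset.inter_filter, Finset.inter_filter]
      refine ih g₁ g₂ X₁ Y₁ hX₁ hY₁ Wp cWp hWp hcWp (F₁ ∩ (E r).powerset)
        (fun ω hω => Finset.mem_powerset.mp (Finset.mem_inter.mp hω).2) ?_
      intro ω hω t ht a b hab hb h1 h2
      obtain ⟨hωF, hωE⟩ := Finset.mem_inter.mp hω
      refine Finset.mem_inter.mpr ⟨hF₁ ω _ ((hrel₁ ω _).mpr (Or.inr ⟨t, ht, a, b, hab, hb, h1, h2, rfl⟩)) hωF, ?_⟩
      rw [Finset.mem_powerset] at hωE ⊢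
      refine Finset.union_subset hωE fun p hp => ?_
      rw [hubB_mem_image_mk, Finset.mem_union, Finset.mem_Icc, Finset.mem_Icc] at hp
      rw [hE]
      refine ⟨by rw [hp.1]; exact ht, ?_, ?_⟩
      · rcases hp.2 with h | h <;> omega
      · rw [hp.1]; rcases hp.2 with h | h <;> omega
    -- H(P_r): the path lemma in set form
    have H₂ : ∀ W₂ F₂ : Finset (Finset ℕ), C₂ W₂ → (∀ x y, rel₂ x y → x ∈ F₂ → y ∈ F₂) →
        (F₂ ∩ W₂).card ≤ (F₂ ∩ W₂.image (fun ζ => ζ ∆ Icc 1 (ℓ r))).card := by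
      intro W₂ F₂ hC hF₂
      obtain ⟨g₁, g₂, X₂, Y₂, hX₂, hY₂, rfl⟩ := (hC₂ W₂).mp hC
      obtain ⟨Wp, hWp⟩ : ∃ Wp : Finset ℕ → Prop, ∀ ζ, Wp ζ ↔ ¬ X₂ (Icc 0 (ri r ζ) ∪ (if g₁ = true then Icc (ℓ r - rj r ζ) (ℓ r) else ∅)) ∧
          Y₂ (Icc 0 (ra r ζ) ∪ (if g₂ = true then Icc (ℓ r - rb r ζ) (ℓ r) else ∅)) := ⟨_, fun _ => Iff.rfl⟩
      have heq : (Icc 1 (ℓ r)).powerset.filter (fun ζ => ¬ X₂ (Icc 0 (ri r ζ) ∪ (if g₁ = true then Icc (ℓ r - rj r ζ) (ℓ r) else ∅)) ∧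
          Y₂ (Icc 0 (ra r ζ) ∪ (if g₂ = true then Icc (ℓ r - rb r ζ) (ℓ r) else ∅))) = (Icc 1 (ℓ r)).powerset.filter (fun ζ => Wp ζ) :=
        Finset.filter_congr fun ζ _ => (hWp ζ).symm
      rw [heq]
      exact hubB_path_setForm (ℓ r) (hℓ r) g₁ g₂ X₂ Y₂ hX₂ hY₂ (D r) (hD r) (ri r) (ra r) (rj r) (rb r) (hri r) (hra r) (hrj r) (hrb r)
        Wp hWp F₂ (fun ζ hζ a b hab hb h1 h2 => hF₂ ζ _ ((hrel₂ ζ _).mpr (Or.inr ⟨a, b, hab, hb, h1, h2, rfl⟩)) hζ)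
    -- the product objects
    obtain ⟨PW, hPW⟩ : ∃ PW : Finset (Finset (ℕ × ℕ)), PW = (E (r + 1)).powerset.filter (fun ω => W ω) := ⟨_, rfl⟩
    have hPWsub : ∀ ω ∈ PW, ω ⊆ E (r + 1) := fun ω hω => by
      rw [hPW, Finset.mem_filter, Finset.mem_powerset] at hω; exact hω.1
    have hjoinE : ∀ ω' : Finset (ℕ × ℕ), ∀ ζ : Finset ℕ, ω' ⊆ E r → (ω' ∪ ζ.image (Prod.mk r) ⊆ E (r + 1) ↔ ζ ⊆ Icc 1 (ℓ r)) := by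
      intro ω' ζ hω'
      constructor
      · intro h
        have := hubB_theta_sub ℓ E hE θ hθ (r + 1) _ h r
        rw [hubB_theta_join_self ℓ E hE θ hθ r ω' hω' ζ] at this
        exact this
      · exact hubB_join_sub ℓ E hE r ω' hω' ζ
    have memW : ∀ ω' ζ, (ω', ζ) ∈ PW.image (fun ω => (ω.filter (fun p => p.1 < r), θ r ω)) ↔
        ω' ⊆ E r ∧ ζ ⊆ Icc 1 (ℓ r) ∧ W (ω' ∪ ζ.image (Prod.mk r)) := by
      intro ω' ζ
      rw [hubB_mem_splitImage ℓ E hE θ hθ r PW hPWsub, hPW, Finset.mem_filter, Finset.mem_powerset]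
      constructor
      · rintro ⟨h1, h2, h3⟩; exact ⟨h1, (hjoinE ω' ζ h1).mp h2, h3⟩
      · rintro ⟨h1, h2, h3⟩; exact ⟨h1, (hjoinE ω' ζ h1).mpr h2, h3⟩
    have memU : ∀ ω' ζ, (ω', ζ) ∈ F.image (fun ω => (ω.filter (fun p => p.1 < r), θ r ω)) ↔
        ω' ⊆ E r ∧ ω' ∪ ζ.image (Prod.mk r) ∈ F := fun ω' ζ => hubB_mem_splitImage ℓ E hE θ hθ r F hFsub ω' ζ
    -- slices at fixed ζ are class members of Θ_r
    have hW₁ : ∀ ζ ∈ (PW.image (fun ω => (ω.filter (fun p => p.1 < r), θ r ω))).image Prod.snd,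
        C₁ (((PW.image (fun ω => (ω.filter (fun p => p.1 < r), θ r ω))).filter (fun p => p.2 = ζ)).image Prod.fst) := by
      intro ζ hζ
      obtain ⟨p, hp, hpζ⟩ := Finset.mem_image.mp hζ
      have hζsub : ζ ⊆ Icc 1 (ℓ r) := by
        have := (memW p.1 p.2).mp (by rw [Prod.mk.eta]; exact hp)
        rw [← hpζ]; exact this.2.1
      obtain ⟨X', hX'⟩ : ∃ X' : Finset (ℕ × ℕ) → Prop, ∀ S, X' S ↔ X (S ∪ (Icc 0 (ri r ζ) ∪
          (if (gX = true ∨ ri r ζ = ℓ r ∨ ∃ t, t < r ∧ (t, ℓ t) ∈ S) then Icc (ℓ r - rj r ζ) (ℓ r) else ∅)).image (Prod.mk r)) :=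
        ⟨_, fun _ => Iff.rfl⟩
      obtain ⟨Y', hY'⟩ : ∃ Y' : Finset (ℕ × ℕ) → Prop, ∀ S, Y' S ↔ Y (S ∪ (Icc 0 (ra r ζ) ∪
          (if (gY = true ∨ ra r ζ = ℓ r ∨ ∃ t, t < r ∧ (t, ℓ t) ∈ S) then Icc (ℓ r - rb r ζ) (ℓ r) else ∅)).image (Prod.mk r)) :=
        ⟨_, fun _ => Iff.rfl⟩
      rw [hC₁]
      refine ⟨gX || decide (ri r ζ = ℓ r), gY || decide (ra r ζ = ℓ r), X', Y', ?_, ?_, ?_⟩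
      · intro S T hST h
        rw [hX'] at h ⊢
        exact hubB_sliceSubst_mono X hXm r ℓ (gX = true) (ri r ζ = ℓ r) _ _ S T hST h
      · intro S T hST h
        rw [hY'] at h ⊢
        exact hubB_sliceSubst_mono Y hYm r ℓ (gY = true) (ra r ζ = ℓ r) _ _ S T hST h
      · ext ω'
        rw [hubProd_mem_sliceFst, memW, Finset.mem_filter, Finset.mem_powerset, hX', hY']
        constructor
        · rintro ⟨h1, _, h3⟩
          rw [hubB_W_join_sliceForm ℓ E hE θ hθ D hD ri ra rj rb hri hra hrj hrb TX TY hTX hTY r gX gY X Y W hW ω' h1 ζ] at h3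
          exact ⟨h1, h3⟩
        · rintro ⟨h1, h3⟩
          rw [← hubB_W_join_sliceForm ℓ E hE θ hθ D hD ri ra rj rb hri hra hrj hrb TX TY hTX hTY r gX gY X Y W hW ω' h1 ζ] at h3
          exact ⟨h1, hζsub, h3⟩
    -- slices at fixed ω' are class members of the path
    have hW₂ : ∀ ω' ∈ (PW.image (fun ω => (ω.filter (fun p => p.1 < r), θ r ω))).image Prod.fst,
        C₂ (((PW.image (fun ω => (ω.filter (fun p => p.1 < r), θ r ω))).filter (fun p => p.1 = ω')).image Prod.snd) := by
      intro ω' hω'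
      obtain ⟨p, hp, hpω⟩ := Finset.mem_image.mp hω'
      have hω'sub : ω' ⊆ E r := by
        have := (memW p.1 p.2).mp (by rw [Prod.mk.eta]; exact hp)
        rw [← hpω]; exact this.1
      obtain ⟨X', hX'⟩ : ∃ X' : Finset ℕ → Prop, ∀ P, X' P ↔ X ((if ℓ r ∈ P then TX true r ω' else TX false r ω') ∪ P.image (Prod.mk r)) :=
        ⟨_, fun _ => Iff.rfl⟩
      obtain ⟨Y', hY'⟩ : ∃ Y' : Finset ℕ → Prop, ∀ P, Y' P ↔ Y ((if ℓ r ∈ P then TY true r ω' else TY false r ω') ∪ P.image (Prod.mk r)) :=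
        ⟨_, fun _ => Iff.rfl⟩
      rw [hC₂]
      refine ⟨gX || decide (∃ s, s < r ∧ ri s (θ s ω') = ℓ s), gY || decide (∃ s, s < r ∧ ra s (θ s ω') = ℓ s), X', Y', ?_, ?_, ?_⟩
      · intro P Q hPQ h
        rw [hX'] at h ⊢
        exact hubB_pathSubst_mono X hXm r (ℓ r) _ _ (hubB_trace_mono_gate ℓ θ ri rj TX hTX false r ω') P Q hPQ h
      · intro P Q hPQ h
        rw [hY'] at h ⊢
        exact hubB_pathSubst_mono Y hYm r (ℓ r) _ _ (hubB_trace_mono_gate ℓ θ ra rb TY hTY false r ω') P Q hPQ h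
      · ext ζ
        rw [hubProd_mem_sliceSnd, memW, Finset.mem_filter, Finset.mem_powerset, hX', hY',
          hubB_W_join_pathForm ℓ E hE θ hθ D hD ri ra rj rb hri hra hrj hrb TX TY hTX hTY r gX gY X Y W hW ω' hω'sub ζ]
        constructor
        · rintro ⟨_, h2, h3⟩; exact ⟨h2, h3⟩
        · rintro ⟨h2, h3⟩; exact ⟨hω'sub, h2, h3⟩
    -- U = F.image split is an up-set of the product relation
    have hU : ∀ p q : Finset (ℕ × ℕ) × Finset ℕ, rel₁ p.1 q.1 → rel₂ p.2 q.2 →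
        p ∈ F.image (fun ω => (ω.filter (fun p => p.1 < r), θ r ω)) → q ∈ F.image (fun ω => (ω.filter (fun p => p.1 < r), θ r ω)) := by
      intro p q h1 h2 hp
      obtain ⟨hp1, hpF⟩ := (memU p.1 p.2).mp (by rw [Prod.mk.eta]; exact hp)
      -- step A: move in Θ_r
      have hA : q.1 ⊆ E r ∧ q.1 ∪ p.2.image (Prod.mk r) ∈ F := by
        rcases (hrel₁ p.1 q.1).mp h1 with heq | ⟨t, ht, a, b, hab, hb, hk1, hk2, hy⟩
        · rw [← heq]; exact ⟨hp1, hpF⟩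
        · constructor
          · rw [hy]
            refine Finset.union_subset hp1 fun x hx => ?_
            rw [hubB_mem_image_mk, Finset.mem_union, Finset.mem_Icc, Finset.mem_Icc] at hx
            rw [hE]
            refine ⟨by rw [hx.1]; exact ht, ?_, ?_⟩
            · rcases hx.2 with h | h <;> omega
            · rw [hx.1]; rcases hx.2 with h | h <;> omega
          · have hθt : θ t (p.1 ∪ p.2.image (Prod.mk r)) = θ t p.1 := hubB_theta_join_ne θ hθ r p.1 p.2 t (by omega)
            have := hFup _ hpF t (by omega) a b hab hb (by rw [hθt]; exact hk1) (by rw [hθt]; exact hk2)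
            rw [hubB_join_move_old] at this
            rw [hy]; exact this
      -- step B: move on the path
      have hB : q.1 ∪ q.2.image (Prod.mk r) ∈ F := by
        rcases (hrel₂ p.2 q.2).mp h2 with heq | ⟨a, b, hab, hb, hk1, hk2, hy⟩
        · rw [← heq]; exact hA.2
        · have hθr : θ r (q.1 ∪ p.2.image (Prod.mk r)) = p.2 := hubB_theta_join_self ℓ E hE θ hθ r q.1 hA.1 p.2
          have := hFup _ hA.2 r (Nat.lt_succ_self r) a b hab hb (by rw [hθr]; exact hk1) (by rw [hθr]; exact hk2)
          rw [hubB_join_move_new] at this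
          rw [hy]; exact this
      have := (memU q.1 q.2).mpr ⟨hA.1, hB⟩
      rw [Prod.mk.eta] at this
      exact this
    -- the product lemma
    have key := hubProduct_card_le rel₁ rel₂ (fun x => (hrel₁ x x).mpr (Or.inl rfl)) (fun y => (hrel₂ y y).mpr (Or.inl rfl))
      (fun x => x ∆ E r) (fun ζ => ζ ∆ Icc 1 (ℓ r)) (hubB_symmDiff_invol (E r)) (hubB_symmDiff_invol (Icc 1 (ℓ r)))
      C₁ C₂ H₁ H₂ (PW.image (fun ω => (ω.filter (fun p => p.1 < r), θ r ω)))
      (F.image (fun ω => (ω.filter (fun p => p.1 < r), θ r ω))) hW₁ hW₂ hU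
    -- split is injective on words of Θ_{r+1}
    have hinj : ∀ G : Finset (Finset (ℕ × ℕ)), (∀ ω ∈ G, ω ⊆ E (r + 1)) →
        Set.InjOn (fun ω : Finset (ℕ × ℕ) => (ω.filter (fun p => p.1 < r), θ r ω)) ↑G := by
      intro G hG ω₁ h₁ ω₂ h₂ h
      obtain ⟨e1, -, -⟩ := hubB_split ℓ E hE θ hθ r ω₁ (hG ω₁ h₁)
      obtain ⟨e2, -, -⟩ := hubB_split ℓ E hE θ hθ r ω₂ (hG ω₂ h₂)
      have hf : ω₁.filter (fun p => p.1 < r) = ω₂.filter (fun p => p.1 < r) := (Prod.mk.inj h).1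
      have hs : θ r ω₁ = θ r ω₂ := (Prod.mk.inj h).2
      rw [e1, e2, hf, hs]
    -- (1) #(F ∩ W) = #(U ∩ Wset)
    have e1 : (F.filter (fun ω => W ω)).card =
        (F.image (fun ω => (ω.filter (fun p => p.1 < r), θ r ω)) ∩ PW.image (fun ω => (ω.filter (fun p => p.1 < r), θ r ω))).card := by
      have hsubW : ∀ ω ∈ F.filter (fun ω => W ω), ω ⊆ E (r + 1) := fun ω hω => hFsub ω (Finset.mem_filter.mp hω).1
      rw [← Finset.card_image_of_injOn (hinj _ hsubW)]
      congr 1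
      ext ⟨ω', ζ⟩
      rw [hubB_mem_splitImage ℓ E hE θ hθ r _ hsubW, Finset.mem_inter, memU, memW, Finset.mem_filter]
      constructor
      · rintro ⟨h1, h2, h3⟩
        exact ⟨⟨h1, h2⟩, h1, (hjoinE ω' ζ h1).mp (hFsub _ h2), h3⟩
      · rintro ⟨⟨h1, h2⟩, _, _, h3⟩
        exact ⟨h1, h2, h3⟩
    -- (2) #(F ∩ cW) = #(U ∩ (c₁ × c₂) Wset)
    have hcm : Function.Involutive (Prod.map (fun x : Finset (ℕ × ℕ) => x ∆ E r) (fun ζ : Finset ℕ => ζ ∆ Icc 1 (ℓ r))) := by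
      intro p
      obtain ⟨a, b⟩ := p
      show (a ∆ E r ∆ E r, b ∆ Icc 1 (ℓ r) ∆ Icc 1 (ℓ r)) = (a, b)
      rw [symmDiff_assoc, symmDiff_self, symmDiff_bot, symmDiff_assoc, symmDiff_self, symmDiff_bot]
    have hcompl := (hubB_compl_filter ℓ hℓ E hE θ hθ D hD ri ra rj rb hri hra hrj hrb TX TY hTX hTY (r + 1) gX gY X Y W cW hW hcW).1
    have e2 : (F.filter (fun ω => cW ω)).card =
        (F.image (fun ω => (ω.filter (fun p => p.1 < r), θ r ω)) ∩ (PW.image (fun ω => (ω.filter (fun p => p.1 < r), θ r ω))).image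
          (Prod.map (fun x : Finset (ℕ × ℕ) => x ∆ E r) (fun ζ : Finset ℕ => ζ ∆ Icc 1 (ℓ r)))).card := by
      have hsubW : ∀ ω ∈ F.filter (fun ω => cW ω), ω ⊆ E (r + 1) := fun ω hω => hFsub ω (Finset.mem_filter.mp hω).1
      rw [← Finset.card_image_of_injOn (hinj _ hsubW)]
      congr 1
      ext ⟨ω', ζ⟩
      rw [hubB_mem_splitImage ℓ E hE θ hθ r _ hsubW, Finset.mem_inter, memU, hubProd_mem_image_invol _ hcm, Prod.map_apply, memW,
        Finset.mem_filter]
      constructor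
      · rintro ⟨h1, h2, h3⟩
        have hζ : ζ ⊆ Icc 1 (ℓ r) := (hjoinE ω' ζ h1).mp (hFsub _ h2)
        have hc1 : ω' ∆ E r = E r \ ω' := hubB_symmDiff_eq_sdiff (E r) ω' h1
        have hc2 : ζ ∆ Icc 1 (ℓ r) = Icc 1 (ℓ r) \ ζ := hubB_symmDiff_eq_sdiff (Icc 1 (ℓ r)) ζ hζ
        refine ⟨⟨h1, h2⟩, ?_, ?_, ?_⟩
        · show ω' ∆ E r ⊆ E r
          rw [hc1]; exact Finset.sdiff_subset
        · show ζ ∆ Icc 1 (ℓ r) ⊆ Icc 1 (ℓ r)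
          rw [hc2]; exact Finset.sdiff_subset
        · show W (ω' ∆ E r ∪ (ζ ∆ Icc 1 (ℓ r)).image (Prod.mk r))
          rw [hc1, hc2, ← hubB_compl_join ℓ E hE r ω' h1 ζ, hcompl _ (hubB_join_sub ℓ E hE r ω' h1 ζ hζ)]
          exact h3
      · rintro ⟨⟨h1, h2⟩, _, _, h3⟩
        have hζ : ζ ⊆ Icc 1 (ℓ r) := (hjoinE ω' ζ h1).mp (hFsub _ h2)
        have hc1 : ω' ∆ E r = E r \ ω' := hubB_symmDiff_eq_sdiff (E r) ω' h1
        have hc2 : ζ ∆ Icc 1 (ℓ r) = Icc 1 (ℓ r) \ ζ := hubB_symmDiff_eq_sdiff (Icc 1 (ℓ r)) ζ hζ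
        refine ⟨h1, h2, ?_⟩
        have h3' : W (ω' ∆ E r ∪ (ζ ∆ Icc 1 (ℓ r)).image (Prod.mk r)) := h3
        rw [hc1, hc2, ← hubB_compl_join ℓ E hE r ω' h1 ζ, hcompl _ (hubB_join_sub ℓ E hE r ω' h1 ζ hζ)] at h3'
        exact h3'
    rw [e1, e2]
    exact key

open Classical in
/-- **THEOREM (HE PURE LEMMA on every bundle, counting form; the single-type half of LP1(Θ)).**  For every bundle
`Θ(ℓ 0, …, ℓ (r-1))`, all monotone 0/1 levels `𝐀, 𝐁, 𝐂, 𝐃` and every up-set `𝒱` of colourings:  `#bad₁(𝒱) ≤ #L₁(𝒱)`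
(module docstring).  Proof: `hubBundle_HJ` with `𝒳 = 𝐂 ∪ ↑b`, `𝒴 = 𝐃 ∩ ↑b`, `F = 𝒱 ∩ {X ∈ 𝐀, Y ∉ 𝐁}` (memo-50 §2.3(a)). [folklore] -/
theorem hubBundle_HEpure (ℓ : ℕ → ℕ) (hℓ : ∀ t, 1 ≤ ℓ t)
    (E : ℕ → Finset (ℕ × ℕ)) (hE : ∀ n p, p ∈ E n ↔ p.1 < n ∧ 1 ≤ p.2 ∧ p.2 ≤ ℓ p.1)
    (θ : ℕ → Finset (ℕ × ℕ) → Finset ℕ) (hθ : ∀ t ω k, k ∈ θ t ω ↔ (t, k) ∈ ω)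
    (D : ℕ → Finset ℕ → Finset ℕ) (hD : ∀ t η, D t η = (Icc 1 (ℓ t - 1)).filter (fun k => ¬ (k ∈ η ↔ k + 1 ∈ η)))
    (ri ra rj rb : ℕ → Finset ℕ → ℕ)
    (hri : ∀ t η, ri t η = if 1 ∈ η then (if h : (D t η).Nonempty then (D t η).min' h else ℓ t) else 0)
    (hra : ∀ t η, ra t η = if 1 ∈ η then 0 else (if h : (D t η).Nonempty then (D t η).min' h else ℓ t))
    (hrj : ∀ t η, rj t η = if ℓ t ∈ η then (if h : (D t η).Nonempty then ℓ t - (D t η).max' h else ℓ t) else 0)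
    (hrb : ∀ t η, rb t η = if ℓ t ∈ η then 0 else (if h : (D t η).Nonempty then ℓ t - (D t η).max' h else ℓ t))
    (TX TY : Bool → ℕ → Finset (ℕ × ℕ) → Finset (ℕ × ℕ))
    (hTX : ∀ g n ω, TX g n ω = (range n).biUnion (fun t => (Icc 0 (ri t (θ t ω)) ∪
      (if (g = true ∨ ∃ s, s < n ∧ ri s (θ s ω) = ℓ s) then Icc (ℓ t - rj t (θ t ω)) (ℓ t) else ∅)).image (Prod.mk t)))
    (hTY : ∀ g n ω, TY g n ω = (range n).biUnion (fun t => (Icc 0 (ra t (θ t ω)) ∪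
      (if (g = true ∨ ∃ s, s < n ∧ ra s (θ s ω) = ℓ s) then Icc (ℓ t - rb t (θ t ω)) (ℓ t) else ∅)).image (Prod.mk t)))
    (r : ℕ) (A B C Dd : Finset (ℕ × ℕ) → Prop)
    (hA : ∀ S T : Finset (ℕ × ℕ), S ⊆ T → A S → A T) (hB : ∀ S T : Finset (ℕ × ℕ), S ⊆ T → B S → B T)
    (hC : ∀ S T : Finset (ℕ × ℕ), S ⊆ T → C S → C T) (hDd : ∀ S T : Finset (ℕ × ℕ), S ⊆ T → Dd S → Dd T)
    (bad₁ L₁ : Finset (ℕ × ℕ) → Prop)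
    (hbad : ∀ ω, bad₁ ω ↔ (¬ (∃ t, t < r ∧ (t, ℓ t) ∈ TX false r ω) ∧ (∃ t, t < r ∧ (t, ℓ t) ∈ TY false r ω)) ∧
      A (TX false r ω) ∧ ¬ B (TY false r ω) ∧ Dd (TY false r ω) ∧ ¬ C (TX false r ω))
    (hL₁ : ∀ ω, L₁ ω ↔ ((∃ t, t < r ∧ (t, ℓ t) ∈ TX false r ω) ∧ ¬ (∃ t, t < r ∧ (t, ℓ t) ∈ TY false r ω)) ∧
      A (TX false r ω) ∧ ¬ B (TY false r ω) ∧ Dd (TX false r ω) ∧ ¬ C (TY false r ω))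
    (𝒱 : Finset (Finset (ℕ × ℕ))) (h𝒱sub : ∀ ω ∈ 𝒱, ω ⊆ E r)
    (h𝒱up : ∀ ω ∈ 𝒱, ∀ ω', ω ⊆ ω' → ω' ⊆ E r → ω' ∈ 𝒱) :
    (𝒱.filter (fun ω => bad₁ ω)).card ≤ (𝒱.filter (fun ω => L₁ ω)).card := by
  -- the gated functionals
  obtain ⟨X, hX⟩ : ∃ X : Finset (ℕ × ℕ) → Prop, ∀ S, X S ↔ C S ∨ ∃ t, t < r ∧ (t, ℓ t) ∈ S := ⟨_, fun _ => Iff.rfl⟩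
  obtain ⟨Y, hY⟩ : ∃ Y : Finset (ℕ × ℕ) → Prop, ∀ S, Y S ↔ Dd S ∧ ∃ t, t < r ∧ (t, ℓ t) ∈ S := ⟨_, fun _ => Iff.rfl⟩
  have hXm : ∀ S T : Finset (ℕ × ℕ), S ⊆ T → X S → X T := by
    intro S T hST h; rw [hX] at h ⊢
    rcases h with h | ⟨t, ht, h⟩
    · exact Or.inl (hC S T hST h)
    · exact Or.inr ⟨t, ht, hST h⟩
  have hYm : ∀ S T : Finset (ℕ × ℕ), S ⊆ T → Y S → Y T := by
    intro S T hST h; rw [hY] at h ⊢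
    obtain ⟨h1, t, ht, h2⟩ := h
    exact ⟨hDd S T hST h1, t, ht, hST h2⟩
  obtain ⟨W, hW⟩ : ∃ W : Finset (ℕ × ℕ) → Prop, ∀ ω, W ω ↔ ¬ X (TX false r ω) ∧ Y (TY false r ω) := ⟨_, fun _ => Iff.rfl⟩
  obtain ⟨cW, hcW⟩ : ∃ cW : Finset (ℕ × ℕ) → Prop, ∀ ω, cW ω ↔ ¬ X (TY false r ω) ∧ Y (TX false r ω) := ⟨_, fun _ => Iff.rfl⟩
  -- the restricted family F = 𝒱 ∩ hro is hub-closed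
  have hmono := hubB_trace_mono ℓ hℓ θ hθ D hD ri ra rj rb hri hra hrj hrb TX TY hTX hTY false r
  have key := hubBundle_HJ ℓ hℓ E hE θ hθ D hD ri ra rj rb hri hra hrj hrb TX TY hTX hTY r false false X Y hXm hYm W cW hW hcW
    (𝒱.filter (fun ω => A (TX false r ω) ∧ ¬ B (TY false r ω)))
    (fun ω hω => h𝒱sub ω (Finset.mem_filter.mp hω).1) ?_
  · rw [Finset.filter_filter, Finset.filter_filter] at key
    have e1 : 𝒱.filter (fun ω => (A (TX false r ω) ∧ ¬ B (TY false r ω)) ∧ W ω) = 𝒱.filter (fun ω => bad₁ ω) := by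
      refine Finset.filter_congr fun ω _ => ?_
      rw [hW, hbad, hX, hY]
      constructor
      · rintro ⟨⟨ha, hb⟩, hc, hd, hq⟩
        exact ⟨⟨fun hp => hc (Or.inr hp), hq⟩, ha, hb, hd, fun h => hc (Or.inl h)⟩
      · rintro ⟨⟨hp, hq⟩, ha, hb, hd, hc⟩
        exact ⟨⟨ha, hb⟩, fun h => h.elim hc hp, hd, hq⟩
    have e2 : 𝒱.filter (fun ω => (A (TX false r ω) ∧ ¬ B (TY false r ω)) ∧ cW ω) = 𝒱.filter (fun ω => L₁ ω) := by
      refine Finset.filter_congr fun ω _ => ?_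
      rw [hcW, hL₁, hX, hY]
      constructor
      · rintro ⟨⟨ha, hb⟩, hc, hd, hp⟩
        exact ⟨⟨hp, fun hq => hc (Or.inr hq)⟩, ha, hb, hd, fun h => hc (Or.inl h)⟩
      · rintro ⟨⟨hp, hq⟩, ha, hb, hd, hc⟩
        exact ⟨⟨ha, hb⟩, fun h => h.elim hc hq, hd, hp⟩
    rw [e1, e2] at key
    exact key
  · intro ω hω t ht a b hab hb h1 h2
    obtain ⟨hω𝒱, hωA, hωB⟩ := Finset.mem_filter.mp hω
    have hsub : ω ⊆ ω ∪ (Icc 1 a ∪ Icc (b + 1) (ℓ t)).image (Prod.mk t) := Finset.subset_union_left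
    have hE' : ω ∪ (Icc 1 a ∪ Icc (b + 1) (ℓ t)).image (Prod.mk t) ⊆ E r := by
      refine Finset.union_subset (h𝒱sub ω hω𝒱) fun p hp => ?_
      rw [hubB_mem_image_mk, Finset.mem_union, Finset.mem_Icc, Finset.mem_Icc] at hp
      rw [hE]
      refine ⟨by rw [hp.1]; exact ht, ?_, ?_⟩
      · rcases hp.2 with h | h <;> omega
      · rw [hp.1]; rcases hp.2 with h | h <;> omega
    refine Finset.mem_filter.mpr ⟨h𝒱up ω hω𝒱 _ hsub hE', ?_, ?_⟩
    · exact hA _ _ (hmono _ _ hsub).1 hωA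
    · exact fun h => hωB (hB _ _ (hmono _ _ hsub).2 h)

end Coefficientwise

end Summit.CriticalPhenomena.PercolationContinuityZ3.Theorems
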